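import Summits.KontsevichZagierPeriods.Zeta5Search.Barrier.ConeGammaTranslateTangentCone

/-!
# ζ(5) search — BARRIER: THE TANGENT CONE AT THE CLOSED ORBIT — the lattice point's own displacement `δ = 0`
# (file (4) of «THE UNIFORM TANGENT CONE»)

HONEST FRAMING (cell `pub-zeta5`): systematic search; no irrationality claim unless kernel-certified. MODEL objects
under Brown–Zudilin's (28)+(30) accounting ([BZ22] = arXiv:2210.03391; (28) observed, not proved); nothing here is a
statement about `ζ(5)`, any `γ` of record, the cone's supremum (C2 OPEN) or the value / sign of the cusp slope or of the
translate integral at a named direction (DATA of the cell): whether `σ ≤ 0` holds in every direction at a NAMED lattice point is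
DATA (ascent directions are known at the directions of record — DATA); NO cancellation is quantified; S-E / (TD_A) stay
CONJECTURED; records in print UNMOVED. Prover P2 g43 (item «THE UNIFORM TANGENT CONE», file (4); plan INBOX 2026-08-28).
Sources: files (1)–(3), P2 g33 `ConeGammaCuspPeriodCanonical` (chamber formula), P2 g28 `ConeGammaCuspSlopeHomogeneous`
(`cuspSlope_smul`, `cuspSlope_zero`), P2 g42 `ConeGammaTranslateRateBall` (Lemma B on the rate ball), the tree's `wallDist_pos`.

SETTING. `a` with all 28 forms positive, `T > 0` a period, `σ = cuspSlope a T`, `P = translateIntegral a T`. The closed orbit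
is the translate `δ = 0`; it lies in the OPEN rate ball (`exists_rateBall_radius`: a radius `ρ̄ > 0` with `2ρ̄·T·x_max² < 1`,
`2ρ̄·x_max < min(1, wallDist a T)` always exists), so files (1)–(3) apply there, and at `δ = 0` every generic reference refines `δ`.
* **`isLocalMax_translateIntegral_zero_iff` — THE CLOSED ORBIT IS A LOCAL MAXIMISER OF THE TRANSLATE INTEGRAL IFF THE CUSP
  SLOPE HAS NO ASCENT DIRECTION** (`σ ≤ 0` everywhere); `isLocalMin_cuspSlope_zero_iff` / `isLocalMin_translateIntegral_zero_iff`
  (the twins with `σ ≥ 0`);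
* **`differentiableAt_cuspSlope_zero_iff_greedy_eq`** — `σ` is differentiable at `0` iff ALL generic references carry one
  chamber functional; **`cuspSlope_eq_fderiv_of_differentiableAt_zero`** — then `σ = fderiv σ 0` is LINEAR;
  **`differentiableAt_cuspSlope_zero_iff_additive` — `σ` IS DIFFERENTIABLE AT THE ORIGIN IFF IT IS ADDITIVE** (a positively
  homogeneous additive function is linear): the cusp of the MODEL saving at the lattice point is a genuine cusp unless `σ` is a
  linear functional; **`differentiableAt_translateIntegral_zero_iff_additive` — THE CLOSED ORBIT IS A KINK OF `P` UNLESS `σ` IS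
  LINEAR**.
NOT here (honest): whether `σ ≤ 0` / `σ` additive holds at any named direction (DATA: at the directions of record ascent directions
exist and `σ(Δ) + σ(−Δ) > 0` somewhere — DATA, not used); `Φ`, `γ`, C2, S-E's truth, `ζ(5)`.
-/

noncomputable section

open Set Finset Filter
open scoped Topology

namespace Summit.KontsevichZagierPeriods.Zeta5Search.Barrier.ConeGamma

/-! ### The closed orbit lies in the open rate ball -/

/-- Pure-real bookkeeping: for `T, x, w > 0` a radius `ρ̄ > 0` with `2ρ̄·T·x² < 1`, `2ρ̄·x < 1`, `2ρ̄·x < w` exists. -/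
theorem exists_small_radius {T x w : ℝ} (hT : 0 < T) (hx : 0 < x) (hw : 0 < w) :
    ∃ ρb : ℝ, 0 < ρb ∧ 2 * ρb * T * x ^ 2 < 1 ∧ 2 * ρb * x < 1 ∧ 2 * ρb * x < w := by
  obtain ⟨m, hm⟩ : ∃ m : ℝ, m = min 1 w := ⟨_, rfl⟩
  obtain ⟨K, hK⟩ : ∃ K : ℝ, K = T * x ^ 2 + x + 1 := ⟨_, rfl⟩
  have hm0 : 0 < m := by rw [hm]; exact lt_min one_pos hw
  have hm1 : m ≤ 1 := by rw [hm]; exact min_le_left _ _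
  have hmw : m ≤ w := by rw [hm]; exact min_le_right _ _
  have hTx : 0 ≤ T * x ^ 2 := mul_nonneg hT.le (sq_nonneg x)
  have hK0 : 0 < K := by rw [hK]; linarith
  refine ⟨m / (4 * K), by positivity, ?_, ?_, ?_⟩
  · have e : 2 * (m / (4 * K)) * T * x ^ 2 = m * (T * x ^ 2) / (2 * K) := by
      field_simp
      ring
    rw [e, div_lt_one (by positivity)]
    nlinarith [mul_le_mul_of_nonneg_right hm1 hTx]
  · have e : 2 * (m / (4 * K)) * x = m * x / (2 * K) := by
      field_simp
      ring
    rw [e, div_lt_one (by positivity)]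
    nlinarith [mul_le_mul_of_nonneg_right hm1 hx.le]
  · have e : 2 * (m / (4 * K)) * x = m * x / (2 * K) := by
      field_simp
      ring
    rw [e, div_lt_iff₀ (by positivity)]
    nlinarith [mul_le_mul_of_nonneg_right hmw hx.le, mul_pos hw hK0]

/-- **A RATE-BALL RADIUS ALWAYS EXISTS**: for all 28 forms of `a` positive and `T > 0` there is `ρ̄ > 0` with `2ρ̄·T·x_max² < 1`,
`2ρ̄·x_max < 1`, `2ρ̄·x_max < wallDist a T` — so the closed orbit `δ = 0` is a translate of the OPEN rate ball. -/
theorem exists_rateBall_radius {a : Dir} (hpos : ∀ k, 0 < h28 a k) {T : ℝ} (hT : 0 < T) :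
    ∃ ρb : ℝ, 0 < ρb ∧ 2 * ρb * T * xMax a ^ 2 < 1 ∧ 2 * ρb * xMax a < 1 ∧ 2 * ρb * xMax a < wallDist a T :=
  exists_small_radius hT (xMax_pos hpos) (wallDist_pos a T)

/-- The rates of the closed orbit vanish: `|r_k(0)| < ρ̄` for every `ρ̄ > 0`. -/
theorem rates_zero_lt {a : Dir} {ρb : ℝ} (hρb : 0 < ρb) (k : Fin 28) :
    |phiForm (0 : Fin 8 → ℝ) k / h28 a k| < ρb := by
  rw [phiForm_zero, zero_div, abs_zero]; exact hρb

/-! ### Extremality of the closed orbit -/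

/-- **THE CLOSED ORBIT IS A LOCAL MAXIMISER OF THE TRANSLATE INTEGRAL IFF THE CUSP SLOPE HAS NO ASCENT DIRECTION.** All 28 forms
of `a` positive, `T > 0` a period. Then **`IsLocalMax (translateIntegral a T) 0 ↔ ∀ Δ, cuspSlope a T Δ ≤ 0`** (Lemma B on the rate
ball: `P(δ) − P(0) = σ(δ)` near `0`; file (2): `IsLocalMax σ 0 ↔ σ ≤ 0`). Whether the right side holds at a named lattice point is
DATA. -/
theorem isLocalMax_translateIntegral_zero_iff {a : Dir} (hpos : ∀ k, 0 < h28 a k) {T : ℝ} (hT : 0 < T)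
    (hper : ∀ k : Fin 28, ∃ z : ℤ, T * h28 a k = z) :
    IsLocalMax (translateIntegral a T) 0 ↔ ∀ Δ : Fin 8 → ℝ, cuspSlope a T Δ ≤ 0 := by
  obtain ⟨ρb, hρb, hρT, hc1, hc2⟩ := exists_rateBall_radius hpos hT
  rw [(translateIntegral_eventuallyEq_cuspSlope_add hpos hT hper (fun k => rates_zero_lt hρb k) hρT hc1 hc2).isLocalMax_iff,
    ← isLocalMax_cuspSlope_zero_iff hpos hT hper]
  show (∀ᶠ x in 𝓝 (0 : Fin 8 → ℝ), cuspSlope a T x + (translateIntegral a T 0 - cuspSlope a T 0) ≤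
      cuspSlope a T 0 + (translateIntegral a T 0 - cuspSlope a T 0)) ↔
    ∀ᶠ x in 𝓝 (0 : Fin 8 → ℝ), cuspSlope a T x ≤ cuspSlope a T 0
  simp only [add_le_add_iff_right]

/-- **`0` IS A LOCAL MINIMISER OF `σ` IFF `σ ≥ 0` EVERYWHERE.** -/
theorem isLocalMin_cuspSlope_zero_iff {a : Dir} (hpos : ∀ k, 0 < h28 a k) {T : ℝ} (hT : 0 < T)
    (hper : ∀ k : Fin 28, ∃ z : ℤ, T * h28 a k = z) :
    IsLocalMin (cuspSlope a T) 0 ↔ ∀ Δ : Fin 8 → ℝ, 0 ≤ cuspSlope a T Δ := by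
  classical
  obtain ⟨F, hF⟩ : ∃ F : Finset (Fin 28) → ℝ,
      ∀ A, F A = ∑ m ∈ Finset.range ((bkpts a T).card - 1), ((patternN a (bkpt a T m) A : ℤ) : ℝ) := ⟨_, fun _ => rfl⟩
  have h0 : ∀ k, phiForm (0 : Fin 8 → ℝ) k / h28 a k = 0 := fun k => by rw [phiForm_zero, zero_div]
  rw [isLocalMin_cuspSlope_iff hpos hT hper hF]
  constructor
  · intro h Δ
    obtain ⟨δ₀, hgen, href⟩ := exists_generic_refines hpos Δ
    rw [cuspSlope_eq_greedy_canonical_of_refines hpos hT hper hF hgen Δ href]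
    exact h Δ δ₀ hgen fun k l hkl => hkl.elim (fun h' => absurd h' (by rw [h0, h0]; exact lt_irrefl _))
      fun h' => href k l h'.2
  · intro h Δ δ₀ hgen hlex
    rw [← cuspSlope_eq_greedy_canonical_of_refines hpos hT hper hF hgen Δ fun k l hkl =>
      hlex k l (Or.inr ⟨by rw [h0, h0], hkl⟩)]
    exact h Δ

/-- **THE CLOSED ORBIT IS A LOCAL MINIMISER OF `P` IFF `σ ≥ 0` EVERYWHERE.** -/
theorem isLocalMin_translateIntegral_zero_iff {a : Dir} (hpos : ∀ k, 0 < h28 a k) {T : ℝ} (hT : 0 < T)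
    (hper : ∀ k : Fin 28, ∃ z : ℤ, T * h28 a k = z) :
    IsLocalMin (translateIntegral a T) 0 ↔ ∀ Δ : Fin 8 → ℝ, 0 ≤ cuspSlope a T Δ := by
  obtain ⟨ρb, hρb, hρT, hc1, hc2⟩ := exists_rateBall_radius hpos hT
  rw [(translateIntegral_eventuallyEq_cuspSlope_add hpos hT hper (fun k => rates_zero_lt hρb k) hρT hc1 hc2).isLocalMin_iff,
    ← isLocalMin_cuspSlope_zero_iff hpos hT hper]
  show (∀ᶠ x in 𝓝 (0 : Fin 8 → ℝ), cuspSlope a T 0 + (translateIntegral a T 0 - cuspSlope a T 0) ≤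
      cuspSlope a T x + (translateIntegral a T 0 - cuspSlope a T 0)) ↔
    ∀ᶠ x in 𝓝 (0 : Fin 8 → ℝ), cuspSlope a T 0 ≤ cuspSlope a T x
  simp only [add_le_add_iff_right]

/-! ### Differentiability at the closed orbit: `σ` linear -/

/-- **`σ` IS DIFFERENTIABLE AT THE ORIGIN IFF ALL GENERIC REFERENCES CARRY ONE CHAMBER FUNCTIONAL** (file (1)'s criterion at
`δ = 0`, where every generic reference refines `δ`). -/
theorem differentiableAt_cuspSlope_zero_iff_greedy_eq {a : Dir} (hpos : ∀ k, 0 < h28 a k) {T : ℝ} (hT : 0 < T)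
    (hper : ∀ k : Fin 28, ∃ z : ℤ, T * h28 a k = z) {F : Finset (Fin 28) → ℝ}
    (hF : ∀ A, F A = ∑ m ∈ Finset.range ((bkpts a T).card - 1), ((patternN a (bkpt a T m) A : ℤ) : ℝ)) :
    DifferentiableAt ℝ (cuspSlope a T) 0 ↔
      ∀ δ₀ δ₀' : Fin 8 → ℝ, (∀ k l : Fin 28, k ≠ l → phiForm δ₀ k / h28 a k ≠ phiForm δ₀ l / h28 a l) →
        (∀ k l : Fin 28, k ≠ l → phiForm δ₀' k / h28 a k ≠ phiForm δ₀' l / h28 a l) →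
        ∀ Δ : Fin 8 → ℝ,
          ∑ k, (F (Finset.univ.filter fun l => phiForm δ₀ k / h28 a k ≤ phiForm δ₀ l / h28 a l) -
              F (Finset.univ.filter fun l => phiForm δ₀ k / h28 a k < phiForm δ₀ l / h28 a l)) *
            (phiForm Δ k / h28 a k) =
          ∑ k, (F (Finset.univ.filter fun l => phiForm δ₀' k / h28 a k ≤ phiForm δ₀' l / h28 a l) -
              F (Finset.univ.filter fun l => phiForm δ₀' k / h28 a k < phiForm δ₀' l / h28 a l)) *
            (phiForm Δ k / h28 a k) := by
  have h0 : ∀ k, phiForm (0 : Fin 8 → ℝ) k / h28 a k = 0 := fun k => by rw [phiForm_zero, zero_div]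
  have hvac : ∀ δ₀ : Fin 8 → ℝ, ∀ k l : Fin 28, phiForm (0 : Fin 8 → ℝ) k / h28 a k < phiForm (0 : Fin 8 → ℝ) l / h28 a l →
      phiForm δ₀ k / h28 a k < phiForm δ₀ l / h28 a l := fun δ₀ k l h =>
    absurd h (by rw [h0, h0]; exact lt_irrefl _)
  rw [differentiableAt_cuspSlope_iff_greedy_eq hpos hT hper hF]
  exact ⟨fun h δ₀ δ₀' hgen hgen' => h δ₀ δ₀' hgen hgen' (hvac δ₀) (hvac δ₀'),
    fun h δ₀ δ₀' hgen hgen' _ _ => h δ₀ δ₀' hgen hgen'⟩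

/-- **IF `σ` IS DIFFERENTIABLE AT THE ORIGIN THEN `σ` IS LINEAR: `σ(Δ) = fderiv σ 0 Δ` for EVERY `Δ`** (a generic reference refining
`Δ` refines `0`; its functional is the derivative (file (1)) and equals `σ(Δ)` (P2 g33's chamber formula)). -/
theorem cuspSlope_eq_fderiv_of_differentiableAt_zero {a : Dir} (hpos : ∀ k, 0 < h28 a k) {T : ℝ} (hT : 0 < T)
    (hper : ∀ k : Fin 28, ∃ z : ℤ, T * h28 a k = z) (hd : DifferentiableAt ℝ (cuspSlope a T) 0) (Δ : Fin 8 → ℝ) :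
    cuspSlope a T Δ = fderiv ℝ (cuspSlope a T) 0 Δ := by
  classical
  obtain ⟨F, hF⟩ : ∃ F : Finset (Fin 28) → ℝ,
      ∀ A, F A = ∑ m ∈ Finset.range ((bkpts a T).card - 1), ((patternN a (bkpt a T m) A : ℤ) : ℝ) := ⟨_, fun _ => rfl⟩
  have h0 : ∀ k, phiForm (0 : Fin 8 → ℝ) k / h28 a k = 0 := fun k => by rw [phiForm_zero, zero_div]
  obtain ⟨δ₀, hgen, href⟩ := exists_generic_refines hpos Δ
  rw [cuspSlope_eq_greedy_canonical_of_refines hpos hT hper hF hgen Δ href]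
  exact greedy_eq_fderiv_of_differentiableAt hpos hT hper hF hd hgen
    (fun k l h => absurd h (by rw [h0, h0]; exact lt_irrefl _)) Δ

/-- **`σ` is homogeneous of degree one for ALL real scalars once it is additive.** -/
theorem cuspSlope_smul_real {a : Dir} (hpos : ∀ k, 0 < h28 a k) {T : ℝ} (hT : 0 < T)
    (hper : ∀ k : Fin 28, ∃ z : ℤ, T * h28 a k = z)
    (hadd : ∀ Δ Δ' : Fin 8 → ℝ, cuspSlope a T (Δ + Δ') = cuspSlope a T Δ + cuspSlope a T Δ') (c : ℝ) (Δ : Fin 8 → ℝ) :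
    cuspSlope a T (c • Δ) = c * cuspSlope a T Δ := by
  rcases lt_trichotomy c 0 with hc | rfl | hc
  · have hneg : cuspSlope a T (c • Δ) + cuspSlope a T ((-c) • Δ) = 0 := by
      rw [← hadd, neg_smul, add_neg_cancel, cuspSlope_zero]
    rw [cuspSlope_smul hpos hT hper Δ (neg_pos.mpr hc)] at hneg
    linarith
  · rw [zero_smul, cuspSlope_zero, zero_mul]
  · exact cuspSlope_smul hpos hT hper Δ hc

/-- **`σ` IS DIFFERENTIABLE AT THE ORIGIN IFF IT IS ADDITIVE.** All 28 forms of `a` positive, `T > 0` a period. Then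
**`DifferentiableAt ℝ (cuspSlope a T) 0 ↔ ∀ Δ Δ', cuspSlope a T (Δ + Δ') = cuspSlope a T Δ + cuspSlope a T Δ'`** — the cusp
of the MODEL saving at the lattice point is a genuine cusp (non-differentiable) unless `σ` is a linear functional (⇒: `σ = fderiv σ 0`;
⇐: an additive positively homogeneous function is a linear map of `ℝ⁸`, hence its own derivative). -/
theorem differentiableAt_cuspSlope_zero_iff_additive {a : Dir} (hpos : ∀ k, 0 < h28 a k) {T : ℝ} (hT : 0 < T)
    (hper : ∀ k : Fin 28, ∃ z : ℤ, T * h28 a k = z) :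
    DifferentiableAt ℝ (cuspSlope a T) 0 ↔
      ∀ Δ Δ' : Fin 8 → ℝ, cuspSlope a T (Δ + Δ') = cuspSlope a T Δ + cuspSlope a T Δ' := by
  constructor
  · intro hd Δ Δ'
    rw [cuspSlope_eq_fderiv_of_differentiableAt_zero hpos hT hper hd (Δ + Δ'),
      cuspSlope_eq_fderiv_of_differentiableAt_zero hpos hT hper hd Δ,
      cuspSlope_eq_fderiv_of_differentiableAt_zero hpos hT hper hd Δ', map_add]
  · intro hadd
    let Lₗ : (Fin 8 → ℝ) →ₗ[ℝ] ℝ :=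
      { toFun := cuspSlope a T
        map_add' := hadd
        map_smul' := fun c Δ => by
          rw [RingHom.id_apply, smul_eq_mul]
          exact cuspSlope_smul_real hpos hT hper hadd c Δ }
    have hL : ∀ Δ, LinearMap.toContinuousLinearMap Lₗ Δ = cuspSlope a T Δ := fun _ => rfl
    have h := (LinearMap.toContinuousLinearMap Lₗ).hasFDerivAt (x := (0 : Fin 8 → ℝ))
    exact (h.congr_of_eventuallyEq (Filter.Eventually.of_forall fun Δ => (hL Δ).symm)).differentiableAt

/-- **THE CLOSED ORBIT IS A KINK OF THE TRANSLATE INTEGRAL UNLESS THE CUSP SLOPE IS LINEAR**: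
`DifferentiableAt ℝ (translateIntegral a T) 0 ↔ ∀ Δ Δ', cuspSlope a T (Δ + Δ') = cuspSlope a T Δ + cuspSlope a T Δ'`. -/
theorem differentiableAt_translateIntegral_zero_iff_additive {a : Dir} (hpos : ∀ k, 0 < h28 a k) {T : ℝ} (hT : 0 < T)
    (hper : ∀ k : Fin 28, ∃ z : ℤ, T * h28 a k = z) :
    DifferentiableAt ℝ (translateIntegral a T) 0 ↔
      ∀ Δ Δ' : Fin 8 → ℝ, cuspSlope a T (Δ + Δ') = cuspSlope a T Δ + cuspSlope a T Δ' := by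
  obtain ⟨ρb, hρb, hρT, hc1, hc2⟩ := exists_rateBall_radius hpos hT
  rw [differentiableAt_translateIntegral_iff_cuspSlope hpos hT hper (fun k => rates_zero_lt hρb k) hρT hc1 hc2]
  exact differentiableAt_cuspSlope_zero_iff_additive hpos hT hper

end Summit.KontsevichZagierPeriods.Zeta5Search.Barrier.ConeGamma

end
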